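/-
Copyright (c) 2026 the pub-hodgecm-mathlib formalisation cell (harness21).  Prover seat hodgecm-mathlib-R90-C131-p05 (g2), R90-TF SLAB section S4
«Ch13.1–2» (base R90-C131), h413 = `stmt-HodgeConjecture-24833`; brick A6′ WEYL-ε of the T-WIF road (S4 dealer K2E2-plan (g7), R90 bus 2026-09-05T01:05:15Z;
HEADS sheet `R90/R90-C131-p03/g2/HEADS-TWIF-tube.v2.md` §A6′).
-/
import Summits.HodgeConjecture.HodgeConjecture.Theorems.F0P3cStCharTSTracePairing      -- ★ (F0P3a-p03): generic `index_centralizer_subgroupOf_normalizer_ne_zero_of_injective` (Weyl group of a regular element is finite)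
import Summits.HodgeConjecture.HodgeConjecture.Theorems.R90S4CartanNormMap               -- ★ p863295 (R90-C131-p03): `epsLoc_mem_centralizer_coe` (`ε_v(T̃) ⊆ T̃`); brings `GtLoc`, `epsLoc`, `IsRegularElt`, `cmDatum … .Local`
import Literature.NumberTheory.Automorphic.UnitaryGroupNonsplitPlace                     -- `UnitaryGroup.LocalRing.eq_iff_apply_eq` (`L ⊗ L⁺_v = L_w` at a non-split place)
import HarnessLib

/-!
# R90-TF · S4 — A6′ WEYL-ε `R90S4EpsWeylFinite`: the ε-twisted Weyl group `W̃^ε_T = Ñ^ε_T ∕ T̃` of the torus `T̃ = Cent_{G̃_v}(γ)` (`γ` regular, `v` non-split)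
# is FINITE (Rogawski 1990, §12.5 pp. 182, 186; §3.5 p. 28; Harish-Chandra 1970, Lemma 42)

Cell `hodgecm-mathlib`, crux H413 = `stmt-HodgeConjecture-24833`, route of record `HCCMUnconditional`; R90-TF section S4 (Rogawski Ch. 13.1–2, base `R90-C131`), seat
R90-C131-p05 (g2); brick A6′ WEYL-ε of R90-C131-p03's T-WIF HEADS sheet v2 (the ε-twisted Weyl integration formula (B1) behind the (W-NP) socket of S4 FILE C): «the
ε-twisted tube over `T̃` has fibre count `|W̃^ε_T|`, `W̃^ε_T := {m ∈ N_{G̃}(T̃) | m (ε m)⁻¹ ∈ T̃} ⧸ T̃` …; the tube count only needs finiteness».  THEOREMS ONLY (no `def`, no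
`instance`, no notation, no named-fact hypothesis, no `sorry`; default heartbeats); ★-only imports; lane `--supports stmt-HodgeConjecture-24833 --as helper` (count-neutral).

THE MATHEMATICS.  `v` a finite place of `L⁺`, `G̃_v = GL₃(L ⊗ L⁺_v)` (★ `GtLoc L v`), `ε = ε_v` the unitary twist at a form `Φ` (★ `epsLoc L Φ v`), `G_v = U(Φ)(L⁺_v)`,
`γ ∈ G_v` regular (separable characteristic polynomial), `T̃ := Cent_{G̃_v}(γ)`, `N(T̃) := N_{G̃_v}(T̃)` its normaliser.  HEADS v2 §A6′ names the ε-NORMALISER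
`Ñ^ε_T := {m ∈ N(T̃) | m (ε m)⁻¹ ∈ T̃}` and `W̃^ε_T := Ñ^ε_T ∕ T̃`.
* (generic, any group `G`, any map `ε : G → G`, any subgroup `T`) **the two descriptions of the ε-normaliser agree**: `x · T · (ε x)⁻¹ = T` (as sets) **iff**
  `x ∈ N(T) ∧ x (ε x)⁻¹ ∈ T` (`image_mul_mul_inv_eq_iff_mem_normalizer_and_mem`): «→» take `t = 1` for `x (ε x)⁻¹ ∈ T`, then `x t x⁻¹ = (x t (ε x)⁻¹)(x (ε x)⁻¹)⁻¹` and
  the injectivity of `t ↦ x t (ε x)⁻¹`; «←» `x t (ε x)⁻¹ = (x t x⁻¹)(x (ε x)⁻¹)`.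
* (generic, `ε : G →* G` a homomorphism) **`Ñ^ε_T` IS A SUBGROUP** (`exists_subgroup_mem_iff_mem_normalizer_and_mul_map_inv_mem`): closure under products is
  `m n (ε(m n))⁻¹ = (m · n (ε n)⁻¹ · m⁻¹)(m (ε m)⁻¹)` with `m ∈ N(T)`, under inverses `m⁻¹ ε(m) = m⁻¹ (m (ε m)⁻¹)⁻¹ m`.  Stated as an EXISTENCE theorem (this file declares no
  `def`); every consumer below takes `Ñ` as ANY subgroup with the HEADS-v2 membership predicate `hÑ : ∀ m, m ∈ Ñ ↔ m ∈ N(T̃) ∧ m (ε m)⁻¹ ∈ T̃`, so a later reviewed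
  `def` plugs in by `Iff.rfl`.
* **`Ñ^ε_T` does NOT reduce to `N(T̃)`** — what `ε(T̃) ⊆ T̃` (★ `epsLoc_mem_centralizer_coe`: `ε` is a homomorphism fixing `γ`) buys is exactly the SANDWICH
  `T̃ ≤ Ñ^ε_T ≤ N(T̃)` (`centralizer_le_of_mem_iff_epsNormalizer`, `le_normalizer_of_mem_iff_epsNormalizer`; generic `le_of_mem_iff_mem_normalizer_and_of_mapsTo`,
  `le_normalizer_of_mem_iff_mem_normalizer_and`): for `t ∈ T̃`, `t (ε t)⁻¹ ∈ T̃`.  In general the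
  inclusion `Ñ^ε_T ≤ N(T̃)` is proper (split diagonal `T̃`, antidiagonal `Φ`: the transposition `(12)` normalises `T̃` but `(12) · ε((12))⁻¹` is a `3`-cycle), and
  `W̃^ε_T ≅ Ω_F(T, G)` [Rogawski1990, §12.5 p. 182] — not used: the tube count needs only finiteness.
* (generic sandwich, `index_subgroupOf_ne_zero_of_le_of_le_normalizer`) `T ≤ Ñ ≤ N(T)` and `[N(T) : T] ≠ 0` give `[Ñ : T] ≠ 0`, indeed `[Ñ : T] ∣ [N(T) : T]`
  (`Subgroup.relIndex_mul_relIndex`).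
* **`[N_{G̃_v}(T̃) : T̃] ≠ 0`** at a NON-SPLIT `v` for every regular `γ ∈ G̃_v` (`index_centralizer_subgroupOf_normalizer_ne_zero_gtLoc`, the `G̃_v`-side twin of ★
  `F0P3cStCharTSWeylFinite.index_centralizer_subgroupOf_normalizer_ne_zero`): the generic ★ `index_centralizer_subgroupOf_normalizer_ne_zero_of_injective` («a group with a
  faithful `N`-dimensional representation in which `g` has separable characteristic polynomial has `[N(Z(g)) : Z(g)] ≤ N!`», [HarishChandra1970, Lemma 42]) at the faithful
  one-place representation `ρ = GL₃(eval_w) : GL₃(∏_{w′∣v} L_{w′}) →* GL₃(L_w)` — injective because `v` is non-split (`L ⊗ L⁺_v = L_w`, `UnitaryGroup.LocalRing.eq_iff_apply_eq`),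
  separability is preserved by `Matrix.charpoly_map`.
* **THE HEADS** (`Φ : GL (Fin 3) L` arbitrary, `γ ∈ U(Φ)(L⁺_v)` regular, `v` non-split, `Ñ` any subgroup with the HEADS-v2 membership predicate):
  `index_centralizer_subgroupOf_epsNormalizer_ne_zero` — `(T̃.subgroupOf Ñ).index ≠ 0`; `finite_epsNormalizer_quotient_centralizer` — `W̃^ε_T = Ñ ⧸ T̃` is a FINITE type;
  `index_centralizer_subgroupOf_epsNormalizer_dvd` — `[Ñ : T̃] ∣ [N(T̃) : T̃]`.

HONEST LABEL: HC_CM is proved only modulo the 7 printed citations (2 remaining named inputs: hLiu418 = `stmt-HodgeConjecture-24832`, h413 = `stmt-HodgeConjecture-24833`) until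
rung 0 closes; WEYL-ε is ONE input of the (B1) T-WIF assembly behind the OPEN (W-NP) socket — a ★ helper closes no socket; REL ≠ ★ ≠ BUILT; count-neutral.

## References
* [Rogawski1990] J. D. Rogawski, *Automorphic Representations of Unitary Groups in Three Variables*, Ann. of Math. Stud. 123 (1990), §12.5 pp. 182, 186 (the twisted
  Weyl integration formula and its constants `|Ω_F(T,G)|⁻¹`), §3.5 p. 28 (`Ω_F(T,G) = N(T)∕T` finite), §3.10–3.11 pp. 33–35 (`G̃_{δε}`, norms on Cartan subgroups).
* [HarishChandra1970] Harish-Chandra (notes by G. van Dijk), *Harmonic Analysis on Reductive p-adic Groups*, LNM 162 (1970), Lemma 42 (finiteness of `N(A)∕Z(A)`).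
-/

set_option autoImplicit false
-- the mandated namespace repeats the single-problem summit's segment (`HodgeConjecture.HodgeConjecture`)
set_option linter.dupNamespace false

noncomputable section

open NumberField IsDedekindDomain
open scoped MatrixGroups
open Literature.NumberTheory.Automorphic Literature.NumberTheory.Automorphic.UnitaryGroup
open Literature.NumberTheory.Rogawski1990 Literature.NumberTheory.Rogawski1990.Ch4Sec10
open Summit.HodgeConjecture.HodgeConjecture.Cruxes.H413.F0P3cStCharTSTracePairing

namespace Summit.HodgeConjecture.HodgeConjecture.R90.S4

/-! ## §1 Generic group theory: the ε-normaliser of a subgroup -/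

section Generic

variable {G : Type*} [Group G]

/-- **The two descriptions of the ε-normaliser agree**: for any map `ε : G → G`, any subgroup `T` and any `x`, the set identity `x · T · (ε x)⁻¹ = T` holds iff
`x` normalises `T` and `x (ε x)⁻¹ ∈ T`. [cite: Rogawski1990, §12.5 p. 186; §3.10 p. 33] -/
theorem image_mul_mul_inv_eq_iff_mem_normalizer_and_mem (ε : G → G) (T : Subgroup G) (x : G) :
    (fun t : G => x * t * (ε x)⁻¹) '' (T : Set G) = (T : Set G) ↔ x ∈ Subgroup.normalizer (T : Set G) ∧ x * (ε x)⁻¹ ∈ T := by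
  constructor
  · intro h
    have hu : x * (ε x)⁻¹ ∈ T := by
      have h1 : x * 1 * (ε x)⁻¹ ∈ (fun t : G => x * t * (ε x)⁻¹) '' (T : Set G) := ⟨1, T.one_mem, rfl⟩
      rw [h, mul_one] at h1
      exact h1
    refine ⟨Subgroup.mem_normalizer_iff.2 fun t => ⟨fun ht => ?_, fun hc => ?_⟩, hu⟩
    · have h1 : x * t * (ε x)⁻¹ ∈ (T : Set G) := by
        rw [← h]
        exact ⟨t, ht, rfl⟩
      have h2 : x * t * x⁻¹ = (x * t * (ε x)⁻¹) * (x * (ε x)⁻¹)⁻¹ := by group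
      rw [h2]
      exact T.mul_mem h1 (T.inv_mem hu)
    · have h1 : x * t * (ε x)⁻¹ ∈ (T : Set G) := by
        have h2 : x * t * (ε x)⁻¹ = (x * t * x⁻¹) * (x * (ε x)⁻¹) := by group
        rw [h2]
        exact T.mul_mem hc hu
      rw [← h] at h1
      obtain ⟨s, hs, hst⟩ := h1
      have hst' : x * s * (ε x)⁻¹ = x * t * (ε x)⁻¹ := hst
      have hse : s = t := mul_left_cancel (mul_right_cancel hst')
      exact hse ▸ hs
  · rintro ⟨hx, hu⟩
    refine Set.Subset.antisymm ?_ fun t ht => ?_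
    · rintro _ ⟨t, ht, rfl⟩
      show x * t * (ε x)⁻¹ ∈ (T : Set G)
      have h2 : x * t * (ε x)⁻¹ = (x * t * x⁻¹) * (x * (ε x)⁻¹) := by group
      rw [h2]
      exact T.mul_mem ((Subgroup.mem_normalizer_iff.1 hx t).1 ht) hu
    · refine ⟨x⁻¹ * (t * (x * (ε x)⁻¹)⁻¹) * x, (Subgroup.mem_normalizer_iff''.1 hx _).1 (T.mul_mem ht (T.inv_mem hu)), ?_⟩
      show x * (x⁻¹ * (t * (x * (ε x)⁻¹)⁻¹) * x) * (ε x)⁻¹ = t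
      group

/-- **The ε-normaliser `Ñ^ε_T = {m ∈ N(T) | m (ε m)⁻¹ ∈ T}` is a subgroup** (`ε : G →* G` a homomorphism, `T` any subgroup): there is a subgroup with exactly this
membership predicate.  Products: `m n (ε(m n))⁻¹ = (m · n (ε n)⁻¹ · m⁻¹)(m (ε m)⁻¹)`; inverses: `m⁻¹ ε(m) = m⁻¹ (m (ε m)⁻¹)⁻¹ m`. [cite: Rogawski1990, §12.5 p. 186] -/
theorem exists_subgroup_mem_iff_mem_normalizer_and_mul_map_inv_mem (ε : G →* G) (T : Subgroup G) :
    ∃ N' : Subgroup G, ∀ m, m ∈ N' ↔ m ∈ Subgroup.normalizer (T : Set G) ∧ m * (ε m)⁻¹ ∈ T := by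
  refine ⟨{ carrier := {m | m ∈ Subgroup.normalizer (T : Set G) ∧ m * (ε m)⁻¹ ∈ T}
            one_mem' := ⟨(Subgroup.normalizer (T : Set G)).one_mem, by rw [map_one, inv_one, mul_one]; exact T.one_mem⟩
            mul_mem' := ?_
            inv_mem' := ?_ }, fun m => Iff.rfl⟩
  · rintro a b ⟨ha, ha'⟩ ⟨hb, hb'⟩
    refine ⟨(Subgroup.normalizer (T : Set G)).mul_mem ha hb, ?_⟩
    have h1 : a * (b * (ε b)⁻¹) * a⁻¹ ∈ T := (Subgroup.mem_normalizer_iff.1 ha _).1 hb'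
    have h2 : a * b * (ε (a * b))⁻¹ = a * (b * (ε b)⁻¹) * a⁻¹ * (a * (ε a)⁻¹) := by
      rw [map_mul, mul_inv_rev]
      group
    rw [h2]
    exact T.mul_mem h1 ha'
  · rintro a ⟨ha, ha'⟩
    refine ⟨(Subgroup.normalizer (T : Set G)).inv_mem ha, ?_⟩
    have h1 : a⁻¹ * (a * (ε a)⁻¹)⁻¹ * a ∈ T := (Subgroup.mem_normalizer_iff''.1 ha _).1 (T.inv_mem ha')
    have h2 : a⁻¹ * (ε a⁻¹)⁻¹ = a⁻¹ * (a * (ε a)⁻¹)⁻¹ * a := by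
      rw [map_inv, inv_inv]
      group
    rw [h2]
    exact h1

/-- **`Ñ^ε_T ≤ N(T)`** for any subgroup `Ñ` with the ε-normaliser membership predicate. [cite: Rogawski1990, §12.5 p. 186] -/
theorem le_normalizer_of_mem_iff_mem_normalizer_and (ε : G → G) (T N' : Subgroup G)
    (hN' : ∀ m, m ∈ N' ↔ m ∈ Subgroup.normalizer (T : Set G) ∧ m * (ε m)⁻¹ ∈ T) : N' ≤ Subgroup.normalizer (T : Set G) :=
  fun m hm => ((hN' m).1 hm).1

/-- **`T ≤ Ñ^ε_T` as soon as `ε(T) ⊆ T`**: for `t ∈ T`, `t ∈ N(T)` and `t (ε t)⁻¹ ∈ T`. [cite: Rogawski1990, §12.5 p. 186] -/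
theorem le_of_mem_iff_mem_normalizer_and_of_mapsTo (ε : G → G) (T N' : Subgroup G)
    (hN' : ∀ m, m ∈ N' ↔ m ∈ Subgroup.normalizer (T : Set G) ∧ m * (ε m)⁻¹ ∈ T) (hε : ∀ t ∈ T, ε t ∈ T) : T ≤ N' :=
  fun t ht => (hN' t).2 ⟨Subgroup.le_normalizer ht, T.mul_mem ht (T.inv_mem (hε t ht))⟩

/-- **Sandwich**: if `T ≤ Ñ ≤ N(T)` then `[Ñ : T]` divides `[N(T) : T]` (`Subgroup.relIndex_mul_relIndex`). [cite: Rogawski1990, §3.5 p. 28] -/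
theorem index_subgroupOf_dvd_of_le_of_le_normalizer {T N' : Subgroup G} (h1 : T ≤ N') (h2 : N' ≤ Subgroup.normalizer (T : Set G)) :
    (T.subgroupOf N').index ∣ (T.subgroupOf (Subgroup.normalizer (T : Set G))).index :=
  Dvd.intro _ (Subgroup.relIndex_mul_relIndex T N' (Subgroup.normalizer (T : Set G)) h1 h2)

/-- **Sandwich**: if `T ≤ Ñ ≤ N(T)` and `[N(T) : T] ≠ 0` then `[Ñ : T] ≠ 0`. [cite: Rogawski1990, §3.5 p. 28] -/
theorem index_subgroupOf_ne_zero_of_le_of_le_normalizer {T N' : Subgroup G} (h1 : T ≤ N') (h2 : N' ≤ Subgroup.normalizer (T : Set G))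
    (hT : (T.subgroupOf (Subgroup.normalizer (T : Set G))).index ≠ 0) : (T.subgroupOf N').index ≠ 0 :=
  fun h0 => hT (Nat.eq_zero_of_zero_dvd (h0 ▸ index_subgroupOf_dvd_of_le_of_le_normalizer h1 h2))

end Generic

/-! ## §2 `G̃_v = GL₃(L ⊗ L⁺_v)` at a non-split place: Weyl finiteness and the ε-normaliser of `T̃ = Cent_{G̃_v}(γ)` -/

section CM

variable (L : Type) [Field L] [NumberField L] [IsCMField L] (Φ : GL (Fin 3) L) (v : HeightOneSpectrum (𝓞 ↥(maximalRealSubfield L)))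

/-- **`[N_{G̃_v}(Z(γ)) : Z(γ)] ≠ 0` for every REGULAR `γ ∈ G̃_v = GL₃(L ⊗ L⁺_v)`, `v` non-split** — the `G̃_v`-side twin of ★
`F0P3cStCharTSWeylFinite.index_centralizer_subgroupOf_normalizer_ne_zero`: the generic ★ `index_centralizer_subgroupOf_normalizer_ne_zero_of_injective` at the faithful
one-place representation `GL₃(eval_w) : GL₃(∏_{w′∣v} L_{w′}) →* GL₃(L_w)` (injective since `L ⊗ L⁺_v = L_w` at a non-split place, `UnitaryGroup.LocalRing.eq_iff_apply_eq`;
separability transported by `Matrix.charpoly_map`). [cite: Rogawski1990, §3.5 p. 28; §12.5 p. 182] [cite: HarishChandra1970, Lemma 42] -/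
theorem index_centralizer_subgroupOf_normalizer_ne_zero_gtLoc (hns : ∀ w : PlacesOver L v, IsCMField.complexConj L • w.1 = w.1) (γ : GtLoc L v)
    (hγ : IsRegularElt γ) :
    ((Subgroup.centralizer ({γ} : Set (GtLoc L v))).subgroupOf
      (Subgroup.normalizer ((Subgroup.centralizer ({γ} : Set (GtLoc L v)) : Subgroup (GtLoc L v)) : Set (GtLoc L v)))).index ≠ 0 := by
  obtain ⟨w⟩ := (inferInstance : Nonempty (PlacesOver L v))
  have hw := hns w
  haveI : Algebra.IsQuadraticExtension ↥(maximalRealSubfield L) L := IsCMField.isQuadraticExtension L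
  -- the faithful one-place representation `ρ = GL₃(eval_w)`
  let ρ : GtLoc L v →* GL (Fin 3) (w.1.adicCompletion L) :=
    Matrix.GeneralLinearGroup.map (Pi.evalRingHom (fun w' : PlacesOver L v => w'.1.adicCompletion L) w)
  have hρ : Function.Injective ρ := by
    intro a b hab
    refine Units.ext (Matrix.ext fun i j => ?_)
    have hij := congrArg (fun u : GL (Fin 3) (w.1.adicCompletion L) => (u : Matrix (Fin 3) (Fin 3) (w.1.adicCompletion L)) i j) hab
    exact (LocalRing.eq_iff_apply_eq (IsCMField.complexConj L) (IsCMField.complexConj_ne_one L) w hw _ _).2 hij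
  have hsep : ((ρ γ : GL (Fin 3) (w.1.adicCompletion L)) : Matrix (Fin 3) (Fin 3) (w.1.adicCompletion L)).charpoly.Separable := by
    have hval : ((ρ γ : GL (Fin 3) (w.1.adicCompletion L)) : Matrix (Fin 3) (Fin 3) (w.1.adicCompletion L)) =
        (γ.val : Matrix (Fin 3) (Fin 3) (LocalRing L v)).map (Pi.evalRingHom (fun w' : PlacesOver L v => w'.1.adicCompletion L) w) := rfl
    rw [hval, Matrix.charpoly_map]
    exact hγ.map
  exact index_centralizer_subgroupOf_normalizer_ne_zero_of_injective ρ hρ γ hsep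

/-- **`N_{G̃_v}(Z(γ)) ∕ Z(γ)` is a FINITE type** for every regular `γ ∈ G̃_v`, `v` non-split. [cite: Rogawski1990, §3.5 p. 28] [cite: HarishChandra1970, Lemma 42] -/
theorem finite_normalizer_quotient_centralizer_gtLoc (hns : ∀ w : PlacesOver L v, IsCMField.complexConj L • w.1 = w.1) (γ : GtLoc L v)
    (hγ : IsRegularElt γ) :
    Finite (↥(Subgroup.normalizer ((Subgroup.centralizer ({γ} : Set (GtLoc L v)) : Subgroup (GtLoc L v)) : Set (GtLoc L v))) ⧸
      (Subgroup.centralizer ({γ} : Set (GtLoc L v))).subgroupOf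
        (Subgroup.normalizer ((Subgroup.centralizer ({γ} : Set (GtLoc L v)) : Subgroup (GtLoc L v)) : Set (GtLoc L v)))) :=
  (Subgroup.fintypeOfIndexNeZero (index_centralizer_subgroupOf_normalizer_ne_zero_gtLoc L v hns γ hγ)).finite

/-- **The ε-normaliser of `T̃ = Cent_{G̃_v}(γ)` EXISTS AS A SUBGROUP** with the HEADS-v2 membership predicate `m ∈ N(T̃) ∧ m (ε m)⁻¹ ∈ T̃` (any `Φ`, any `v`, any
`γ ∈ U(Φ)(L⁺_v)`). [cite: Rogawski1990, §12.5 p. 186] -/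
theorem exists_epsNormalizer (γ : (UnitaryGroup.cmDatum L 3 (Φ : Matrix (Fin 3) (Fin 3) L)).Local v) :
    ∃ N' : Subgroup (GtLoc L v), ∀ m, m ∈ N' ↔
      m ∈ Subgroup.normalizer ((Subgroup.centralizer ({(γ.val : GtLoc L v)} : Set (GtLoc L v)) : Subgroup (GtLoc L v)) : Set (GtLoc L v)) ∧
        m * (epsLoc L Φ v m)⁻¹ ∈ Subgroup.centralizer ({(γ.val : GtLoc L v)} : Set (GtLoc L v)) :=
  exists_subgroup_mem_iff_mem_normalizer_and_mul_map_inv_mem (epsLoc L Φ v) _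

/-- **`T̃ ≤ Ñ^ε_T`**: `ε_v(T̃) ⊆ T̃` (★ `epsLoc_mem_centralizer_coe`), so every `t ∈ T̃` has `t (ε t)⁻¹ ∈ T̃`. [cite: Rogawski1990, §12.5 p. 186] -/
theorem centralizer_le_of_mem_iff_epsNormalizer (γ : (UnitaryGroup.cmDatum L 3 (Φ : Matrix (Fin 3) (Fin 3) L)).Local v) (N' : Subgroup (GtLoc L v))
    (hN' : ∀ m, m ∈ N' ↔
      m ∈ Subgroup.normalizer ((Subgroup.centralizer ({(γ.val : GtLoc L v)} : Set (GtLoc L v)) : Subgroup (GtLoc L v)) : Set (GtLoc L v)) ∧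
        m * (epsLoc L Φ v m)⁻¹ ∈ Subgroup.centralizer ({(γ.val : GtLoc L v)} : Set (GtLoc L v))) :
    Subgroup.centralizer ({(γ.val : GtLoc L v)} : Set (GtLoc L v)) ≤ N' :=
  le_of_mem_iff_mem_normalizer_and_of_mapsTo (epsLoc L Φ v) _ N' hN' fun _ ht => epsLoc_mem_centralizer_coe γ ht

/-- **`Ñ^ε_T ≤ N_{G̃_v}(T̃)`** (built into the membership predicate). [cite: Rogawski1990, §12.5 p. 186] -/
theorem le_normalizer_of_mem_iff_epsNormalizer (γ : (UnitaryGroup.cmDatum L 3 (Φ : Matrix (Fin 3) (Fin 3) L)).Local v) (N' : Subgroup (GtLoc L v))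
    (hN' : ∀ m, m ∈ N' ↔
      m ∈ Subgroup.normalizer ((Subgroup.centralizer ({(γ.val : GtLoc L v)} : Set (GtLoc L v)) : Subgroup (GtLoc L v)) : Set (GtLoc L v)) ∧
        m * (epsLoc L Φ v m)⁻¹ ∈ Subgroup.centralizer ({(γ.val : GtLoc L v)} : Set (GtLoc L v))) :
    N' ≤ Subgroup.normalizer ((Subgroup.centralizer ({(γ.val : GtLoc L v)} : Set (GtLoc L v)) : Subgroup (GtLoc L v)) : Set (GtLoc L v)) :=
  le_normalizer_of_mem_iff_mem_normalizer_and (epsLoc L Φ v) _ N' hN'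

/-- **`[Ñ^ε_T : T̃] ∣ [N_{G̃_v}(T̃) : T̃]`** for the ε-normaliser of `T̃ = Cent_{G̃_v}(γ)` (any `Φ`, `v`, `γ`). [cite: Rogawski1990, §12.5 pp. 182, 186; §3.5 p. 28] -/
theorem index_centralizer_subgroupOf_epsNormalizer_dvd (γ : (UnitaryGroup.cmDatum L 3 (Φ : Matrix (Fin 3) (Fin 3) L)).Local v) (N' : Subgroup (GtLoc L v))
    (hN' : ∀ m, m ∈ N' ↔
      m ∈ Subgroup.normalizer ((Subgroup.centralizer ({(γ.val : GtLoc L v)} : Set (GtLoc L v)) : Subgroup (GtLoc L v)) : Set (GtLoc L v)) ∧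
        m * (epsLoc L Φ v m)⁻¹ ∈ Subgroup.centralizer ({(γ.val : GtLoc L v)} : Set (GtLoc L v))) :
    ((Subgroup.centralizer ({(γ.val : GtLoc L v)} : Set (GtLoc L v))).subgroupOf N').index ∣
      ((Subgroup.centralizer ({(γ.val : GtLoc L v)} : Set (GtLoc L v))).subgroupOf
        (Subgroup.normalizer ((Subgroup.centralizer ({(γ.val : GtLoc L v)} : Set (GtLoc L v)) : Subgroup (GtLoc L v)) : Set (GtLoc L v)))).index :=
  index_subgroupOf_dvd_of_le_of_le_normalizer (centralizer_le_of_mem_iff_epsNormalizer L Φ v γ N' hN') (le_normalizer_of_mem_iff_epsNormalizer L Φ v γ N' hN')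

/-- **A6′ WEYL-ε (index form): `(T̃.subgroupOf Ñ^ε_T).index ≠ 0`** for `T̃ = Cent_{G̃_v}(γ)`, `γ ∈ U(Φ)(L⁺_v)` REGULAR, `v` NON-SPLIT, and `Ñ^ε_T` the ε-normaliser
(any subgroup with the HEADS-v2 membership predicate `m ∈ N(T̃) ∧ m (ε m)⁻¹ ∈ T̃`): the sandwich `T̃ ≤ Ñ^ε_T ≤ N(T̃)` and `[N(T̃) : T̃] ≠ 0`.
[cite: Rogawski1990, §12.5 pp. 182, 186; §3.5 p. 28] [cite: HarishChandra1970, Lemma 42] -/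
theorem index_centralizer_subgroupOf_epsNormalizer_ne_zero (hns : ∀ w : PlacesOver L v, IsCMField.complexConj L • w.1 = w.1)
    (γ : (UnitaryGroup.cmDatum L 3 (Φ : Matrix (Fin 3) (Fin 3) L)).Local v) (hγ : IsRegularElt (γ.val : GL (Fin 3) (LocalRing L v)))
    (N' : Subgroup (GtLoc L v))
    (hN' : ∀ m, m ∈ N' ↔
      m ∈ Subgroup.normalizer ((Subgroup.centralizer ({(γ.val : GtLoc L v)} : Set (GtLoc L v)) : Subgroup (GtLoc L v)) : Set (GtLoc L v)) ∧
        m * (epsLoc L Φ v m)⁻¹ ∈ Subgroup.centralizer ({(γ.val : GtLoc L v)} : Set (GtLoc L v))) :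
    ((Subgroup.centralizer ({(γ.val : GtLoc L v)} : Set (GtLoc L v))).subgroupOf N').index ≠ 0 :=
  index_subgroupOf_ne_zero_of_le_of_le_normalizer (centralizer_le_of_mem_iff_epsNormalizer L Φ v γ N' hN')
    (le_normalizer_of_mem_iff_epsNormalizer L Φ v γ N' hN') (index_centralizer_subgroupOf_normalizer_ne_zero_gtLoc L v hns γ.val hγ)

/-- **A6′ WEYL-ε: the ε-twisted Weyl group `W̃^ε_T = Ñ^ε_T ∕ T̃` is a FINITE type** (`γ ∈ U(Φ)(L⁺_v)` regular, `v` non-split, `Ñ^ε_T` any subgroup with the HEADS-v2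
membership predicate). [cite: Rogawski1990, §12.5 pp. 182, 186; §3.5 p. 28] [cite: HarishChandra1970, Lemma 42] -/
theorem finite_epsNormalizer_quotient_centralizer (hns : ∀ w : PlacesOver L v, IsCMField.complexConj L • w.1 = w.1)
    (γ : (UnitaryGroup.cmDatum L 3 (Φ : Matrix (Fin 3) (Fin 3) L)).Local v) (hγ : IsRegularElt (γ.val : GL (Fin 3) (LocalRing L v)))
    (N' : Subgroup (GtLoc L v))
    (hN' : ∀ m, m ∈ N' ↔
      m ∈ Subgroup.normalizer ((Subgroup.centralizer ({(γ.val : GtLoc L v)} : Set (GtLoc L v)) : Subgroup (GtLoc L v)) : Set (GtLoc L v)) ∧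
        m * (epsLoc L Φ v m)⁻¹ ∈ Subgroup.centralizer ({(γ.val : GtLoc L v)} : Set (GtLoc L v))) :
    Finite (↥N' ⧸ (Subgroup.centralizer ({(γ.val : GtLoc L v)} : Set (GtLoc L v))).subgroupOf N') :=
  (Subgroup.fintypeOfIndexNeZero (index_centralizer_subgroupOf_epsNormalizer_ne_zero L Φ v hns γ hγ N' hN')).finite

/-- **A6′ WEYL-ε, packaged**: for `γ ∈ U(Φ)(L⁺_v)` regular at a non-split `v` there IS a subgroup `Ñ^ε_T ≤ G̃_v` with the HEADS-v2 membership predicate, sandwiched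
`T̃ ≤ Ñ^ε_T ≤ N_{G̃_v}(T̃)`, with `(T̃.subgroupOf Ñ^ε_T).index ≠ 0`. [cite: Rogawski1990, §12.5 pp. 182, 186; §3.5 p. 28] [cite: HarishChandra1970, Lemma 42] -/
theorem exists_epsNormalizer_index_ne_zero (hns : ∀ w : PlacesOver L v, IsCMField.complexConj L • w.1 = w.1)
    (γ : (UnitaryGroup.cmDatum L 3 (Φ : Matrix (Fin 3) (Fin 3) L)).Local v) (hγ : IsRegularElt (γ.val : GL (Fin 3) (LocalRing L v))) :
    ∃ N' : Subgroup (GtLoc L v),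
      (∀ m, m ∈ N' ↔
        m ∈ Subgroup.normalizer ((Subgroup.centralizer ({(γ.val : GtLoc L v)} : Set (GtLoc L v)) : Subgroup (GtLoc L v)) : Set (GtLoc L v)) ∧
          m * (epsLoc L Φ v m)⁻¹ ∈ Subgroup.centralizer ({(γ.val : GtLoc L v)} : Set (GtLoc L v))) ∧
      Subgroup.centralizer ({(γ.val : GtLoc L v)} : Set (GtLoc L v)) ≤ N' ∧
      N' ≤ Subgroup.normalizer ((Subgroup.centralizer ({(γ.val : GtLoc L v)} : Set (GtLoc L v)) : Subgroup (GtLoc L v)) : Set (GtLoc L v)) ∧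
      ((Subgroup.centralizer ({(γ.val : GtLoc L v)} : Set (GtLoc L v))).subgroupOf N').index ≠ 0 := by
  obtain ⟨N', hN'⟩ := exists_epsNormalizer L Φ v γ
  exact ⟨N', hN', centralizer_le_of_mem_iff_epsNormalizer L Φ v γ N' hN', le_normalizer_of_mem_iff_epsNormalizer L Φ v γ N' hN',
    index_centralizer_subgroupOf_epsNormalizer_ne_zero L Φ v hns γ hγ N' hN'⟩

end CM

end Summit.HodgeConjecture.HodgeConjecture.R90.S4

end
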